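import Summits.HubbardSuperconductivity.HubbardSuperconductivity.Theorems.LevyLogBootstrapDressHalfFilledPairResolventApprox
import HarnessLib

/-!
# Crux `DressHalfFilled` (stmt-HubbardSuperconductivity-8148, route `LevyLogBootstrap`; shared with route
# `AnisotropyChord`): Kato's two-body kernel between MATRIX-valued (operator-inserted) arguments — three
# registered (W1)-certificate stubs

Support file (`--supports stmt-HubbardSuperconductivity-8148`) for STUB 1 `stub_plaquetteData`, clause (W1)
(the window `0 < J`, `0 ≤ V < 2J` of the second-order pair-boson couplings at `U = 2`). The certificate chain
registered on the item (stubs `dressHalfFilled_w1_*`) evaluates the couplings as sums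
`Σ_{l',l} pairResolvent hH E (A'·,l') (A·,l) e_{l'} e_l` of Kato's kernel `pairResolvent`
(`ClusterPairBosonCouplings`) over the columns of two operator-inserted matrices `A', A`. Here, for any
Hermitian `H : Matrix m m ℂ`:

* `dressHalfFilled_w1_pairResolventMatVecMulVec` — for rank-one insertions `A' = a cᵀ`, `A = b dᵀ` the matrix sum
  IS the kernel: `Σ_{l',l} K(E; (a cᵀ)·,l', (b dᵀ)·,l; e_{l'}, e_l) = K(E; a, b; c, d)` (sesquilinearity in the
  four arguments and `Σ_{l'} c̄_{l'} u(l') = ⟨c, u⟩`);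
* `dressHalfFilled_w1_pairResolventMatSmulSmul` — scaling both insertions by `γ` scales the sum by `|γ|²`;
* `dressHalfFilled_w1_residualIntCastEq` — the integer bookkeeping identity that clears the denominators of a
  certificate residual `A − (L + R − E_t·y)` with `E_t = e·10⁻⁹` and `y` in units of `10⁻⁷`:
  it equals `(1/100)·(100A − 100L − 100R + e·y)` entrywise (exact arithmetic over `ℤ`, cast to `ℂ`).

Sources: T. Kato, *Perturbation Theory for Linear Operators* (1966) I-§5.3 (5.32); W.-F. Tsai, S. A. Kivelson,
PRB 73 (2006) 214510, App. A. Elementary algebra; no definition and no named fact is introduced; sorry-free.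
REUSED: `pairResolvent_smul₁/₂` (`…DressHalfFilledPairResolventApprox`), `sum_comm_four'`
(`…DressHalfFilledPairResolventSylvester`).
-/

noncomputable section

set_option linter.dupNamespace false

namespace Summit.HubbardSuperconductivity.HubbardSuperconductivity.Theorems.LevyLogBootstrap

open Matrix Finset Literature.MathematicalPhysics.QuantumLattice
open scoped ComplexOrder

section Generic

variable {m : Type*} [Fintype m] [DecidableEq m]

omit [Fintype m] [DecidableEq m] in
/-- A column of a rank-one matrix: `(a cᵀ)·,l = c_l • a`. [folklore] -/
theorem col_vecMulVec_eq_smul (a c : m → ℂ) (l : m) : (fun i => vecMulVec a c i l) = c l • a := by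
  funext i
  rw [vecMulVec_apply, Pi.smul_apply, smul_eq_mul, mul_comm]

omit [Fintype m] [DecidableEq m] in
/-- A column of a scaled matrix: `(γ A)·,l = γ • A·,l`. [folklore] -/
theorem col_smul_eq_smul (γ : ℂ) (A : Matrix m m ℂ) (l : m) :
    (fun i => (γ • A) i l) = γ • fun i => A i l := by
  funext i
  rw [Matrix.smul_apply, Pi.smul_apply]

/-- `⟨e_l, u⟩ = u_l` for the coordinate vector `e_l = Pi.single l 1`. [folklore] -/
theorem star_single_dotProduct (l : m) (u : m → ℂ) : star (Pi.single l (1 : ℂ)) ⬝ᵥ u = u l := by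
  rw [← Pi.single_star, star_one, single_dotProduct, one_mul]

/-- `⟨u, e_l⟩ = ū_l`. [folklore] -/
theorem star_dotProduct_single (u : m → ℂ) (l : m) : star u ⬝ᵥ Pi.single l (1 : ℂ) = star (u l) := by
  rw [dotProduct_single, mul_one, Pi.star_apply]

/-- **Kato's kernel over the columns of rank-one insertions is the kernel itself**:
`Σ_{l',l} K(E; (a cᵀ)·,l', (b dᵀ)·,l; e_{l'}, e_l) = K(E; a, b; c, d)` — conjugate-linearity in the first and
third arguments, linearity in the second and fourth, and `Σ_{l'} c̄_{l'} u_ν(l') = ⟨c, u_ν⟩`,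
`Σ_l d_l ū_ν(l) = ⟨u_ν, d⟩`. Kato (1966) I-§5.3. [folklore] -/
theorem pairResolvent_colSum_vecMulVec {H : Matrix m m ℂ} (hH : H.IsHermitian) (E : ℝ) (a b c d : m → ℂ) :
    (∑ l', ∑ l, pairResolvent hH E (fun i => vecMulVec a c i l') (fun i => vecMulVec b d i l)
      (Pi.single l' 1) (Pi.single l 1)) = pairResolvent hH E a b c d := by
  simp only [col_vecMulVec_eq_smul, pairResolvent_smul₁, pairResolvent_smul₂]
  -- expand the remaining kernels and collect the `l', l` sums into the two dot products
  simp only [pairResolvent, star_single_dotProduct, star_dotProduct_single, Finset.mul_sum]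
  rw [sum_comm_four']
  refine Finset.sum_congr rfl fun μ _ => Finset.sum_congr rfl fun ν _ => ?_
  have hc : star c ⬝ᵥ ⇑(hH.eigenvectorBasis ν) = ∑ l', star (c l') * (⇑(hH.eigenvectorBasis ν)) l' := by
    rw [dotProduct]; rfl
  have hd : star ⇑(hH.eigenvectorBasis ν) ⬝ᵥ d = ∑ l, star ((⇑(hH.eigenvectorBasis ν)) l) * d l := by
    rw [dotProduct]; rfl
  rw [hc, hd, Finset.sum_mul_sum, Finset.mul_sum, Finset.sum_mul]
  refine Finset.sum_congr rfl fun l' _ => ?_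
  rw [Finset.mul_sum, Finset.sum_mul]
  refine Finset.sum_congr rfl fun l _ => ?_
  ring

/-- **Scaling both insertions by `γ` scales the column sum of Kato's kernel by `|γ|²`.** [folklore] -/
theorem pairResolvent_colSum_smul_smul {H : Matrix m m ℂ} (hH : H.IsHermitian) (E : ℝ) (γ : ℂ)
    (A' A : Matrix m m ℂ) :
    (∑ l', ∑ l, pairResolvent hH E (fun i => (γ • A') i l') (fun i => (γ • A) i l)
      (Pi.single l' 1) (Pi.single l 1)) =
      ((‖γ‖ ^ 2 : ℝ) : ℂ) * (∑ l', ∑ l, pairResolvent hH E (fun i => A' i l') (fun i => A i l)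
        (Pi.single l' 1) (Pi.single l 1)) := by
  simp only [col_smul_eq_smul, pairResolvent_smul₁, pairResolvent_smul₂, Finset.mul_sum]
  refine Finset.sum_congr rfl fun l' _ => Finset.sum_congr rfl fun l _ => ?_
  rw [← mul_assoc, Complex.star_def, Complex.mul_conj', Complex.ofReal_pow]

end Generic

/-- **Clearing denominators in a certificate residual** (exact integer bookkeeping): with `E_t = e·10⁻⁹` and
the trial matrix in units of `10⁻⁷`, `A − (L + R − E_t·(y·10⁷)) = (1/100)·(100A − 100L − 100R + e·y)`
entrywise. [bookkeeping] -/
theorem residual_intCast_eq {ι κ : Type} (A L R y : ι → κ → ℤ) {Et : ℝ} {e : ℤ}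
    (he : (e : ℝ) = Et * 1000000000) :
    (Matrix.of fun I J => ((A I J : ℤ) : ℂ)) - ((Matrix.of fun I J => ((L I J : ℤ) : ℂ)) +
      (Matrix.of fun I J => ((R I J : ℤ) : ℂ)) - ((Et : ℝ) : ℂ) • (Matrix.of fun I J =>
        ((y I J * 10000000 : ℤ) : ℂ))) =
      (((1 : ℝ) / 100 : ℝ) : ℂ) • Matrix.of fun I J =>
        ((100 * A I J - 100 * L I J - 100 * R I J + e * y I J : ℤ) : ℂ) := by
  ext I J
  simp only [Matrix.sub_apply, Matrix.add_apply, Matrix.smul_apply, Matrix.of_apply, smul_eq_mul]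
  push_cast
  have he' : ((e : ℤ) : ℂ) = ((Et : ℝ) : ℂ) * 1000000000 := by
    rw [show ((e : ℤ) : ℂ) = ((e : ℝ) : ℂ) by norm_cast, he]
    push_cast
    ring
  rw [he']
  ring

/-! ### The registered stubs, verbatim -/

/-- Registered stub `dressHalfFilled_w1_pairResolventMatVecMulVec` (item stmt-HubbardSuperconductivity-8148, (W1)
certificate chain): Kato's kernel over the columns of rank-one insertions is the kernel itself
(`pairResolvent_colSum_vecMulVec`). Kato (1966) I-§5.3. [folklore] -/
theorem dressHalfFilled_w1_pairResolventMatVecMulVec : ∀ {m : Type} [Fintype m] [DecidableEq m] {H : Matrix m m ℂ} (hH : H.IsHermitian) (E : ℝ) (a b c d : m → ℂ), (∑ l', ∑ l, pairResolvent hH E (fun i => vecMulVec a c i l') (fun i => vecMulVec b d i l) (Pi.single l' 1) (Pi.single l 1)) = pairResolvent hH E a b c d :=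
  fun hH E a b c d => pairResolvent_colSum_vecMulVec hH E a b c d

/-- Registered stub `dressHalfFilled_w1_pairResolventMatSmulSmul` (item stmt-HubbardSuperconductivity-8148, (W1)
certificate chain): scaling both insertions by `γ` scales the column sum by `|γ|²`
(`pairResolvent_colSum_smul_smul`). [folklore] -/
theorem dressHalfFilled_w1_pairResolventMatSmulSmul : ∀ {m : Type} [Fintype m] [DecidableEq m] {H : Matrix m m ℂ} (hH : H.IsHermitian) (E : ℝ) (γ : ℂ) (A' A : Matrix m m ℂ), (∑ l', ∑ l, pairResolvent hH E (fun i => (γ • A') i l') (fun i => (γ • A) i l) (Pi.single l' 1) (Pi.single l 1)) = ((‖γ‖ ^ 2 : ℝ) : ℂ) * (∑ l', ∑ l, pairResolvent hH E (fun i => A' i l') (fun i => A i l) (Pi.single l' 1) (Pi.single l 1)) :=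
  fun hH E γ A' A => pairResolvent_colSum_smul_smul hH E γ A' A

/-- Registered stub `dressHalfFilled_w1_residualIntCastEq` (item stmt-HubbardSuperconductivity-8148, (W1)
certificate chain): clearing denominators in a certificate residual (`residual_intCast_eq`). [bookkeeping] -/
theorem dressHalfFilled_w1_residualIntCastEq : ∀ {ι κ : Type} (A L R y : ι → κ → ℤ) {Et : ℝ} {e : ℤ}, (e : ℝ) = Et * 1000000000 → (Matrix.of fun I J => ((A I J : ℤ) : ℂ)) - ((Matrix.of fun I J => ((L I J : ℤ) : ℂ)) + (Matrix.of fun I J => ((R I J : ℤ) : ℂ)) - ((Et : ℝ) : ℂ) • (Matrix.of fun I J => ((y I J * 10000000 : ℤ) : ℂ))) = (((1 : ℝ) / 100 : ℝ) : ℂ) • Matrix.of fun I J => ((100 * A I J - 100 * L I J - 100 * R I J + e * y I J : ℤ) : ℂ) :=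
  fun A L R y _ _ he => residual_intCast_eq A L R y he

end Summit.HubbardSuperconductivity.HubbardSuperconductivity.Theorems.LevyLogBootstrap

end
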